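import Summits.ABC.IUTFork.LDHSplitBadPrimeNumberField
import Mathlib.Analysis.SpecificLimits.Normed
import HarnessLib

/-!
# The fork at [IUTchIII] Corollary 3.12, L-DH level: at LARGE `l` the TRUE side of the bad-mass fork needs only `β_p ≤ β < 1` —
# the FALSE side of the sharp model requires an (asymptotically) TOTALLY bad prime

Proof-only companion (D-0012; 0 definitions, no `Prop` fact) of abc-iut-c312-3's `GenuineLogThetaSplitBadPrimes.lean` and of
`LDHSplitBadPrimeNumberField.lean` (abc-iut-w5-d018, p430071); WAVE-5 prover abc-iut-w5-d018 (gen 4). TAKES NO SIDE on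
[IUTchIII] Cor. 3.12.

abc-iut-c312-3's sufficient condition `ThetaVolumeInput.cor312Of_of_badMass_le` reads: if
`c_p := (1/ℓ⋇)·Σ_{i<ℓ⋇} (i+1)²·β_p^{i+1} ≤ 1` at every support prime then `Cor312NonarchOf I ∧ Cor312Of I`. The thresholds of
record are UNIFORM in `l`: `β_p ≤ 1/3` (c312-3, termwise) and `β_p ≤ 1/2` (p430071, `Σ_{i<m}(i+1)²/2^{i+1} ≤ m`). THIS FILE records
the `l`-DEPENDENT form: since `Σ_{n≥1} n²·β^n` CONVERGES for `0 ≤ β < 1`, the averaged coefficient `c_p ≤ (1/ℓ⋇)·Σ_{n≥1} n² β^n`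
tends to `0` as `l → ∞`; so for every `β < 1` there is `L(β)` with: `ℓ⋇ ≥ L(β)` and `β_p ≤ β` at every support prime ⇒
`Cor312Of`.

* `SplitBadPrime.summable_sq_mul_pow` / `sum_sq_pow_le_tsum` — summability of `(n+1)²·β^{n+1}` (Mathlib
  `summable_pow_mul_geometric_of_norm_lt_one`) and «partial sum ≤ sum»;
* **`ThetaVolumeInput.exists_lstar_bound_cor312Of_of_badMass_le`** — for every `β` with `0 ≤ β < 1` there is `L : ℕ` such that EVERY
  genuine Θ-volume input `I` (any `F₀ ⊆ K`) with `L ≤ ℓ⋇` and bad mass `≤ β` at every support prime satisfies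
  `Cor312NonarchOf I ∧ Cor312Of I` — whatever the depths `ord_v(q_v)`, `K`, the ideles;
* **`ThetaVolumeInput.cor312Of_of_badMass_le_of_tsum_le`** — the explicit form: `Σ' n, (n+1)²β^{n+1} ≤ ℓ⋇` suffices.

READING (neutral): in the tree's sharp Dupuy–Hilado-level model ((Ind1) = all capsule-index permutations, STEPV-IND1-NOTE R2), as the
prime `l` grows — and initial Θ-data want `l` LARGE ([IUTchIV] Cor. 2.2: `l ≥ …·height`) — the TRUE side of the bad-mass fork
absorbs every input none of whose bad primes is totally bad (`β_p ≤ β < 1`); the FALSE side (abc-iut-w5-d157: ONE deep prime with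
`𝕍^bad ⊇ V(F₀)_p`, `β_p = 1`; over `F_mod = ℚ` every bad prime has `β_p = 1`) is, at large `l`, confined to inputs with an
(essentially) TOTALLY bad prime. Place combinatorics, orthogonal to the dispute. HONEST SCOPE as the parent files: theorems about
OUR typed objects; `Cor312Of` asserted for no initial Θ-data; typed ≠ proved. [cite: DupuyHilado2025, §3.6, §4.7, §4.12]
[cite: Mochizuki2012, IUTchIII Cor. 3.12 p. 173–174] [claim: Mochizuki2012, status: disputed] for every IUT quotation.
-/

noncomputable section

open Finset NumberField IsDedekindDomain Literature.IUT.LogVolume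

namespace Summit.ABC.IUTFork

/-! ## Summability of `n² βⁿ` and the partial-sum bound -/

namespace SplitBadPrime

/-- For `0 ≤ β < 1` the series `Σ_n (n+1)²·β^{n+1}` converges (Mathlib: `n^k r^n` is summable for `‖r‖ < 1`). [folklore] -/
theorem summable_sq_mul_pow {β : ℝ} (h0 : 0 ≤ β) (h1 : β < 1) :
    Summable (fun n : ℕ => (((n : ℝ) + 1) ^ 2 * β ^ (n + 1))) := by
  have hs : Summable (fun n : ℕ => ((n : ℝ) ^ 2 * β ^ n)) :=
    summable_pow_mul_geometric_of_norm_lt_one 2 (by rwa [Real.norm_eq_abs, abs_of_nonneg h0])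
  have := (summable_nat_add_iff 1).mpr hs
  refine this.congr fun n => ?_
  push_cast
  ring

/-- «Partial sum ≤ sum» for the nonnegative series `Σ (n+1)²·β^{n+1}`, `0 ≤ β < 1` (`Fin` form). [folklore] -/
theorem sum_sq_pow_le_tsum {β : ℝ} (h0 : 0 ≤ β) (h1 : β < 1) (m : ℕ) :
    ∑ i : Fin m, ((((i : ℕ) : ℝ) + 1) ^ 2 * β ^ ((i : ℕ) + 1)) ≤ ∑' n : ℕ, (((n : ℝ) + 1) ^ 2 * β ^ (n + 1)) := by
  rw [Fin.sum_univ_eq_sum_range (fun n => (((n : ℝ) + 1) ^ 2 * β ^ (n + 1))) m]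
  exact (summable_sq_mul_pow h0 h1).sum_le_tsum (range m) fun n _ => by positivity

end SplitBadPrime

/-! ## The `l`-dependent bad-mass threshold -/

section LargeL

variable {F₀ : Type} [Field F₀] [NumberField F₀] {K : Type} [Field K] [NumberField K] [Algebra F₀ K]

/-- **Explicit `l`-dependent threshold**: if `0 ≤ β < 1`, `Σ' n, (n+1)²·β^{n+1} ≤ ℓ⋇` and the bad mass of the genuine input `I`
is `≤ β` at every support prime, then `Cor312NonarchOf I ∧ Cor312Of I` (abc-iut-c312-3's `cor312Of_of_badMass_le` with
`(1/ℓ⋇)·Σ_{i<ℓ⋇}(i+1)²β_p^{i+1} ≤ (1/ℓ⋇)·Σ' ≤ 1`). Typed objects; no side taken on print's Cor. 3.12.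
[claim: Mochizuki2012, status: disputed] [cite: DupuyHilado2025, §3.6, §4.7, §4.12] -/
theorem ThetaVolumeInput.cor312Of_of_badMass_le_of_tsum_le (I : ThetaVolumeInput F₀ K) {β : ℝ} (h0 : 0 ≤ β) (h1 : β < 1)
    (hL : ∑' n : ℕ, (((n : ℝ) + 1) ^ 2 * β ^ (n + 1)) ≤ (I.lstar : ℝ))
    (h : ∀ p ∈ I.supportPrimes,
      ∑ v : placesOver F₀ p, (I.X.S : Set (HeightOneSpectrum (𝓞 F₀))).indicator (weight F₀) v.1 ≤ β) :
    I.Cor312NonarchOf ∧ I.Cor312Of := by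
  have hc : ∀ p ∈ I.supportPrimes, (1 / (I.lstar : ℝ)) * ∑ i : Fin I.lstar, (((i : ℕ) + 1 : ℝ) ^ 2) *
      (∑ v : placesOver F₀ p, (I.X.S : Set (HeightOneSpectrum (𝓞 F₀))).indicator (weight F₀) v.1) ^ ((i : ℕ) + 1) ≤ 1 := by
    intro p hpT
    have hβ0 := I.badMass_nonneg p
    have hβ := h p hpT
    have hsum : ∑ i : Fin I.lstar, (((i : ℕ) + 1 : ℝ) ^ 2) *
        (∑ v : placesOver F₀ p, (I.X.S : Set (HeightOneSpectrum (𝓞 F₀))).indicator (weight F₀) v.1) ^ ((i : ℕ) + 1) ≤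
        I.lstar := by
      calc ∑ i : Fin I.lstar, (((i : ℕ) + 1 : ℝ) ^ 2) *
            (∑ v : placesOver F₀ p, (I.X.S : Set (HeightOneSpectrum (𝓞 F₀))).indicator (weight F₀) v.1) ^ ((i : ℕ) + 1)
          ≤ ∑ i : Fin I.lstar, ((((i : ℕ) : ℝ) + 1) ^ 2 * β ^ ((i : ℕ) + 1)) :=
            Finset.sum_le_sum fun i _ =>
              mul_le_mul_of_nonneg_left (pow_le_pow_left₀ hβ0 hβ _) (sq_nonneg _)
        _ ≤ ∑' n : ℕ, (((n : ℝ) + 1) ^ 2 * β ^ (n + 1)) := SplitBadPrime.sum_sq_pow_le_tsum h0 h1 I.lstar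
        _ ≤ I.lstar := hL
    rcases Nat.eq_zero_or_pos I.lstar with hz | hpos
    · rw [hz]; simp
    · have hl : (0 : ℝ) < I.lstar := by exact_mod_cast hpos
      rw [one_div, inv_mul_le_iff₀ hl, mul_one]
      exact hsum
  exact ⟨I.cor312NonarchOf_of_badMass_le hc, I.cor312Of_of_badMass_le hc⟩

/-- **At large `l` the TRUE side needs only `β_p ≤ β < 1`.** For every `β ∈ [0,1)` there is `L : ℕ` such that every genuine
Θ-volume input over `F₀ ⊆ K` with `L ≤ ℓ⋇` whose bad places over each rational prime carry at most the fraction `β` of the degree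
satisfies Dupuy–Hilado's (1.1) (`Cor312NonarchOf`) and [IUTchIII] Cor. 3.12 as typed (`Cor312Of`) — whatever the depths, `K`, the
ideles. So in the sharp model the FALSE side (abc-iut-w5-d157: a deep prime with `β_p = 1`) is, as `l → ∞`, confined to inputs with
an essentially totally bad prime. Typed objects; no side taken on print's Cor. 3.12. [claim: Mochizuki2012, status: disputed]
[cite: DupuyHilado2025, §3.6, §4.7, §4.12] -/
theorem ThetaVolumeInput.exists_lstar_bound_cor312Of_of_badMass_le {β : ℝ} (h0 : 0 ≤ β) (h1 : β < 1) :
    ∃ L : ℕ, ∀ I : ThetaVolumeInput F₀ K, L ≤ I.lstar →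
      (∀ p ∈ I.supportPrimes,
        ∑ v : placesOver F₀ p, (I.X.S : Set (HeightOneSpectrum (𝓞 F₀))).indicator (weight F₀) v.1 ≤ β) →
      I.Cor312NonarchOf ∧ I.Cor312Of := by
  refine ⟨⌈∑' n : ℕ, (((n : ℝ) + 1) ^ 2 * β ^ (n + 1))⌉₊, fun I hL h => ?_⟩
  refine ThetaVolumeInput.cor312Of_of_badMass_le_of_tsum_le I h0 h1 ?_ h
  exact (Nat.le_ceil _).trans (by exact_mod_cast hL)

end LargeL

end Summit.ABC.IUTFork

end
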